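import Mathlib
import Summits.KontsevichZagierPeriods.KontsevichZagierPeriods.Theses.InverseLandau
import Summits.KontsevichZagierPeriods.KontsevichZagierPeriods.Theorems.InverseLandauTateLiftingRatPolyDense
import Summits.KontsevichZagierPeriods.KontsevichZagierPeriods.Theorems.InverseLandauTateLiftingPolynomialArc
import Summits.KontsevichZagierPeriods.KontsevichZagierPeriods.Theorems.InverseLandauTateLiftingCornerShift
import Summits.KontsevichZagierPeriods.KontsevichZagierPeriods.Theorems.InverseLandauTateLiftingTateSubst
import Summits.KontsevichZagierPeriods.KontsevichZagierPeriods.Theorems.InverseLandauTateLiftingArcSpecialisation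
import Summits.KontsevichZagierPeriods.KontsevichZagierPeriods.Theorems.InverseLandauTateLiftingTateAnalyticContinuation
import Summits.KontsevichZagierPeriods.KontsevichZagierPeriods.Theorems.InverseLandauTateLiftingTateToGen

/-!
# `TateLifting` (stmt-KontsevichZagierPeriods-9129), line `Sketch` — normal form of the crux

`closure T = closure 𝒢` and hence `TateLifting ↔ GenLifting`, UNCONDITIONALLY: the crux — stated
with fibres at real-algebraic parameters of ONE-parameter rational Tate families over `ℚ`, admissible
and identically vanishing on `(0,ε)` — is EQUIVALENT to the generation statement for GENERIC FIBRES: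
specialisations at algebraic points of MULTI-parameter rational families with a Tate corner,
admissible and identically vanishing on an open parameter region joined to the corner.
`𝒢 ⊆ T` is `tateLifting_genFibres_subset_tateFibres` (polynomial arcs; Transfer file);
`T ⊆ 𝒢` is `tateLifting_tateToGen tateLifting_tateAnalyticContinuation` (compactness at the Tate
corner + analytic continuation of the period function across `ϖ = 0`).

So the conjecture-grade residue of the line (`GenLifting`, stub 6 of
`Cruxes/TateLifting/Lines/Sketch.lean`) is not merely sufficient for the crux: it IS the crux.
-/

noncomputable section

namespace Summit.KontsevichZagierPeriods.InverseLandau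

open Literature.NumberTheory.Transcendental

/-- **The two generating sets have the same closure**: Tate fibres (one parameter, vanishing on
`(0,ε)`) and generic fibres (any number of parameters, vanishing on an open corner region) generate
the same subgroup of `KZ.FormalRep`. [folklore] -/
theorem tateLifting_closure_tateFibres_eq_closure_genFibres :
    AddSubgroup.closure
      {d : KZ.FormalRep | ∃ (n : ℕ) (P Q : MvPolynomial (Fin (n + 1)) ℚ) (ε ϖ₀ : ℝ)
          (r : KZ.IntegralRep n), 0 < ε ∧
        (∃ c₀ : ℚ, c₀ ≠ 0 ∧ ∀ z : Fin n → ℝ,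
          MvPolynomial.aeval (Fin.snoc z (0 : ℝ) : Fin (n + 1) → ℝ) Q = (c₀ : ℝ)) ∧
        (∀ (z : Fin n → ℝ) (ϖ : ℝ), (∀ i, z i ∈ Set.Icc (0 : ℝ) 1) → ϖ ∈ Set.Ioo 0 ε →
          MvPolynomial.aeval (Fin.snoc z ϖ : Fin (n + 1) → ℝ) Q ≠ 0) ∧
        (∀ ϖ ∈ Set.Ioo (0 : ℝ) ε, ∫ z in Set.pi Set.univ (fun _ : Fin n => Set.Ioo (0 : ℝ) 1),
          MvPolynomial.aeval (Fin.snoc z ϖ : Fin (n + 1) → ℝ) P /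
            MvPolynomial.aeval (Fin.snoc z ϖ : Fin (n + 1) → ℝ) Q = 0) ∧
        IsAlgebraic ℚ ϖ₀ ∧ ϖ₀ ∈ Set.Ioo 0 ε ∧
        r.domain = Set.pi Set.univ (fun _ : Fin n => Set.Ioo (0 : ℝ) 1) ∧
        Set.EqOn r.integrand (fun z => MvPolynomial.aeval (Fin.snoc z ϖ₀ : Fin (n + 1) → ℝ) P /
          MvPolynomial.aeval (Fin.snoc z ϖ₀ : Fin (n + 1) → ℝ) Q) r.domain ∧
        d = KZ.of r} =
    AddSubgroup.closure
      {d : KZ.FormalRep | ∃ (n k : ℕ) (P Q : MvPolynomial (Fin (n + k)) ℚ) (U : Set (Fin k → ℝ))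
          (γ : ℝ → (Fin k → ℝ)) (a : Fin k → ℝ) (r : KZ.IntegralRep n),
        IsOpen U ∧ ContinuousOn γ (Set.Icc 0 1) ∧ γ 0 = 0 ∧ γ 1 = a ∧
        (∀ t ∈ Set.Icc (0 : ℝ) 1, γ t ∈ U) ∧
        (∃ c₀ : ℚ, c₀ ≠ 0 ∧ ∀ z : Fin n → ℝ,
          MvPolynomial.aeval (Fin.append z (0 : Fin k → ℝ)) Q = (c₀ : ℝ)) ∧
        (∀ (z : Fin n → ℝ) (u : Fin k → ℝ), (∀ i, z i ∈ Set.Icc (0 : ℝ) 1) → u ∈ U →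
          MvPolynomial.aeval (Fin.append z u) Q ≠ 0) ∧
        (∀ u ∈ U, ∫ z in Set.pi Set.univ (fun _ : Fin n => Set.Ioo (0 : ℝ) 1),
          MvPolynomial.aeval (Fin.append z u) P / MvPolynomial.aeval (Fin.append z u) Q = 0) ∧
        (∀ j, IsAlgebraic ℚ (a j)) ∧
        r.domain = Set.pi Set.univ (fun _ : Fin n => Set.Ioo (0 : ℝ) 1) ∧
        Set.EqOn r.integrand (fun z => MvPolynomial.aeval (Fin.append z a) P /
          MvPolynomial.aeval (Fin.append z a) Q) r.domain ∧
        d = KZ.of r} :=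
  le_antisymm
    (AddSubgroup.closure_mono (tateLifting_tateToGen tateLifting_tateAnalyticContinuation))
    (AddSubgroup.closure_mono
        (tateLifting_arcSpecialisation tateLifting_cornerShift
          (tateLifting_polynomialArc tateLifting_ratPolyDense) tateLifting_tateSubst))

/-- **Normal form of the crux `TateLifting`** (unconditional): `TateLifting` is EQUIVALENT to the
generation statement `GenLifting` — every formal combination with vanishing evaluation lies in
`KZ.relations ⊔ closure 𝒢`, `𝒢` the generic fibres (algebraic specialisations of multi-parameter
rational vanishing identities with a Tate corner over an open corner region). [folklore] -/
theorem tateLifting_iff_genLifting :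
    Summit.KontsevichZagierPeriods.KontsevichZagierPeriods.Theses.InverseLandau.TateLifting ↔
    ∀ c : KZ.FormalRep, KZ.eval c = 0 → c ∈ KZ.relations ⊔ AddSubgroup.closure
      {d : KZ.FormalRep | ∃ (n k : ℕ) (P Q : MvPolynomial (Fin (n + k)) ℚ) (U : Set (Fin k → ℝ))
          (γ : ℝ → (Fin k → ℝ)) (a : Fin k → ℝ) (r : KZ.IntegralRep n),
        IsOpen U ∧ ContinuousOn γ (Set.Icc 0 1) ∧ γ 0 = 0 ∧ γ 1 = a ∧
        (∀ t ∈ Set.Icc (0 : ℝ) 1, γ t ∈ U) ∧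
        (∃ c₀ : ℚ, c₀ ≠ 0 ∧ ∀ z : Fin n → ℝ,
          MvPolynomial.aeval (Fin.append z (0 : Fin k → ℝ)) Q = (c₀ : ℝ)) ∧
        (∀ (z : Fin n → ℝ) (u : Fin k → ℝ), (∀ i, z i ∈ Set.Icc (0 : ℝ) 1) → u ∈ U →
          MvPolynomial.aeval (Fin.append z u) Q ≠ 0) ∧
        (∀ u ∈ U, ∫ z in Set.pi Set.univ (fun _ : Fin n => Set.Ioo (0 : ℝ) 1),
          MvPolynomial.aeval (Fin.append z u) P / MvPolynomial.aeval (Fin.append z u) Q = 0) ∧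
        (∀ j, IsAlgebraic ℚ (a j)) ∧
        r.domain = Set.pi Set.univ (fun _ : Fin n => Set.Ioo (0 : ℝ) 1) ∧
        Set.EqOn r.integrand (fun z => MvPolynomial.aeval (Fin.append z a) P /
          MvPolynomial.aeval (Fin.append z a) Q) r.domain ∧
        d = KZ.of r} :=
  ⟨fun h c hc => sup_le le_sup_left
      ((AddSubgroup.closure_mono
        (tateLifting_tateToGen tateLifting_tateAnalyticContinuation)).trans le_sup_right) (h c hc),
    fun h c hc => sup_le le_sup_left
      ((AddSubgroup.closure_mono
        (tateLifting_arcSpecialisation tateLifting_cornerShift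
          (tateLifting_polynomialArc tateLifting_ratPolyDense) tateLifting_tateSubst)).trans
        le_sup_right)
      (h c hc)⟩

end Summit.KontsevichZagierPeriods.InverseLandau

end
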